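import Summits.QuantumFields.BalabanUV.T4Continuum.Support.TransportedSiteAveraging

/-!
# T⁴ programme, spine node NE2 (U1a) — THE SHIFTED ZEROTH-ORDER SHAPE `siteMul(z_k)·T_k` (a bounded colour field times a lattice
# shift): `PerturbationLaws` on the colour-lifted King tower (the one new catalogue shape of the lattice Weitzenböck / plaquette terms;
# owner's scope note `t4/b2b-balaban-t4-ne2-p1/SCOPE-ROOTB-vs-NE2PLUS.md` Δ5)

Tenth generation of the NE2 prover lineage P1 of the cell `pub-balaban`, file 4.  [Balaban1985BackgroundPropagators] (3.10) p.392 defines `Δ(U)` as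
the Hessian of the Wilson action: a covariant-curl form plus the commutator term «tr Σ_{b₁,b₂⊂∂p, b₁<b₂}[A(b₁), A(b₂)]η^{−2}Im U(∂p)»,
and (3.26) adds `DRD*`.  Against row B2's COMPONENTWISE covariant Laplacian `Σ_ν(∇^R_ν)ᴴ∇^R_ν` the difference consists — by the lattice
Weitzenböck-type identity `D*D + DD* = Σ_μ D_μ*D_μ + Σ_{μ≠ν} c²(hol_{μν} − 1)·(shift)` and by the bond-pair structure of the commutator term —
of operators of ONE shape not yet in the catalogue: a bounded colour field (holonomy defect `c²(R(∂p) − 1)`, `η^{−2}Im U(∂p)` = O(field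
strength)) times a UNIT LATTICE SHIFT.  This file puts that shape into the catalogue, at MODEL LEVEL (fields and shifts as data):

 * §1 the hypothesis SHAPE **`ShiftLaws L M a ha T ct`** on a level family `T_k` (‖T_k‖ ≤ 1 and the SANDWICHED intertwining
   `‖(T_{k+1}(J_k⊗1) − (J_k⊗1)T_k)(𝒢^{(k)}⊗1)‖ ≤ ct/L^k`) and **`perturbationLaws_siteMul_mul`**: `BoundedBackgroundM z α β` (size + two-level
   consistency at the block parent — NE3's currency via `NE2FromNE3`) and `ShiftLaws T ct` ⟹
   `PerturbationLaws (Δ_a⊗1) (k ↦ siteMul (z k) * T k) (J⊗1) (α·Cst) (k ↦ Cst(α·ct + β·Cst)·L^{−k})`;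
 * §2 the instances: **`shiftLaws_fwd μ`** (`T_k = S_μ ⊗ 1`, from `BlockPairingGeometry.shift_sub_one_mul_JK`: `S′J − JS = (F_μ − 1)J(S − 1)` and
   (1.89) `‖∇𝒢‖ ≤ Cst`: `ct = Cst`), **`shiftLaws_bwd μ`** (`T_k = S_μᴴ ⊗ 1`, via `S′ᴴJ − JSᴴ = −S′ᴴ(S′J − JS)Sᴴ`), **`shiftLaws_one`**;
   **`perturbationLaws_shiftedZerothOrder_fwd/bwd`** and the η-rate **`towerLimitRate_shiftedZerothOrder_fwd`** (all orders in `t`).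

HONEST FRAMING (T4-DAG p. 1).  A catalogue shape at model level (colour fields / shifts as DATA); it does NOT assert the Weitzenböck identity for
Bałaban's `Δ(U)` nor the dictionary B0 (those are the b05/an2 lineages' reading and a future row); finite torus, linear layer, operator norm; rates /
pairings / constants OURS; nothing printed is a hypothesis; no `def … : Prop` fact; NOT infinite volume / mass gap / Clay / summit progress; spine 0/9
unchanged.  HONEST DEPENDENCY: continuum YM on T⁴ ⇐ BetaPertH ∧ nine spine estimates (0/9 proved); BetaPertH ⇐ (D1) ∧ (D4) ∧ CAP+tail; G-an2-4
gates asym, D1 and NE2/3/4.  ABSOLUTE RULE kept; no `sorry`.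
-/

noncomputable section

open scoped BigOperators ComplexConjugate Matrix Matrix.Norms.L2Operator Kronecker

namespace Summit.QuantumFields.BalabanUV.T4Continuum.ShiftedZerothOrder

open Literature.MathematicalPhysics.QuantumFieldTheory.Balaban1983to89.B5Prop11Plancherel
open Literature.MathematicalPhysics.QuantumFieldTheory.Balaban1983to89.B5G183RateUnitTower (lev lev_neZero)
open Summit.QuantumFields.BalabanUV.T4Continuum
open Summit.QuantumFields.BalabanUV.T4Continuum.CovariantAveragingTower (TowerLimitRate)
open Summit.QuantumFields.BalabanUV.T4Continuum.BalabanAveragedTowerUnit (idx Qlev calGlev one_le_lev' cast_lev')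
open Summit.QuantumFields.BalabanUV.T4Continuum.BackgroundResolventTower
open Summit.QuantumFields.BalabanUV.T4Continuum.KingPairingPlantedLaw
open Summit.QuantumFields.BalabanUV.T4Continuum.BlockPairingGeometry (parT faceF shift_sub_one_mul_JK opNorm_shiftM_le conjTranspose_shiftM_mul
  opNorm_diagonal_le)
open Summit.QuantumFields.BalabanUV.T4Continuum.NE2PerturbedLayer
open Summit.QuantumFields.BalabanUV.T4Continuum.PerturbationAlgebra
open Summit.QuantumFields.BalabanUV.T4Continuum.KroneckerLift
open Summit.QuantumFields.BalabanUV.T4Continuum.BlockMultiplication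
open Summit.QuantumFields.BalabanUV.T4Continuum.ColourCovariantLaplacian (BoundedBackgroundM)
open Summit.QuantumFields.BalabanUV.T4Continuum.BalabanLineAverage (shiftM_sub_one_eq)
open Summit.QuantumFields.BalabanUV.T4Continuum.TransportedSiteAveraging (Dc Jc Ac freeTowerLaws_c)

variable {d : ℕ} (L : ℕ) [NeZero L] (M : Fin d → ℕ) [hM : ∀ μ, NeZero (M μ)] (a : ℝ) (ha : 0 < a) {o : Type*} [Fintype o] [DecidableEq o]

/-! ## §1 Shift laws and the shifted zeroth-order law -/

/-- **THE LAWS OF A SHIFT FAMILY** (hypothesis SHAPE on data): contractions `T_k` on the colour-lifted level spaces whose intertwining defect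
against King's pairing is small AFTER one free propagator: `‖(T_{k+1}(J_k⊗1) − (J_k⊗1)T_k)(𝒢^{(k)}⊗1)‖ ≤ ct/L^k`. [folklore] -/
structure ShiftLaws (T : (k : ℕ) → Matrix (idx L M k × o) (idx L M k × o) ℂ) (ct : ℝ) : Prop where
  /-- `0 ≤ ct` -/
  nonneg : 0 ≤ ct
  /-- contractions -/
  opNorm_le : ∀ k, ‖T k‖ ≤ 1
  /-- sandwiched intertwining -/
  intertwine_le : ∀ k, ‖(T (k + 1) * Jc L M (o := o) k - Jc L M (o := o) k * T k) * (Dc L M a ha (o := o) k)⁻¹‖ ≤ ct / (lev L k : ℕ)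

/-- `‖(Δ_a^{(k)} ⊗ 1)⁻¹‖ ≤ Cst`. [cite: Balaban1984PropagatorsI, Prop. 1.1 (1.89) p.33] [folklore] -/
theorem opNorm_Dc_inv_le (k : ℕ) : ‖(Dc L M a ha (o := o) k)⁻¹‖ ≤ Cst d a := by
  rw [Dc, kron_inv]; exact opNorm_kron_le_of_le o (opNorm_inv_calDalev_le L M a ha k)

/-- King's pairing through colour multiplications at the tower's index types. [folklore] -/
theorem Jc_mul_siteMul (z : (k : ℕ) → idx L M k → Matrix o o ℂ) (k : ℕ) :
    Jc L M (o := o) k * siteMul (z k) = siteMul (fun i : idx L M (k + 1) => z k (parT (lev L k) L M i)) * Jc L M (o := o) k :=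
  kronJK_mul_siteMul (lev L k) L M (z k)

/-- **THE SHIFTED ZEROTH-ORDER LAW**: a bounded, two-level consistent colour field times a shift family satisfies
`PerturbationLaws (Δ_a⊗1) (k ↦ siteMul (z k) * T k) (J⊗1) (α·Cst) (k ↦ Cst·(α·ct + β·Cst)·L^{−k})`. [folklore] -/
theorem perturbationLaws_siteMul_mul {z : (k : ℕ) → idx L M k → Matrix o o ℂ} {α β : ℝ} (hz : BoundedBackgroundM L M z α β)
    {T : (k : ℕ) → Matrix (idx L M k × o) (idx L M k × o) ℂ} {ct : ℝ} (hT : ShiftLaws L M a ha T ct) :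
    PerturbationLaws (Dc L M a ha) (fun k => siteMul (z k) * T k) (Jc L M) (α * Cst d a)
      (fun k => Cst d a * (α * ct + β * Cst d a) * ((L : ℝ)⁻¹) ^ k) where
  opNorm_P_mul_inv_le := fun k => by
    have hC := Cst_nonneg d a
    calc _ ≤ ‖siteMul (z k) * T k‖ * ‖(Dc L M a ha (o := o) k)⁻¹‖ := Matrix.l2_opNorm_mul _ _
      _ ≤ (α * 1) * Cst d a := mul_le_mul ((Matrix.l2_opNorm_mul _ _).trans (mul_le_mul (opNorm_siteMul_le _ hz.nonneg.1 (hz.bound k))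
          (hT.opNorm_le k) (norm_nonneg _) hz.nonneg.1)) (opNorm_Dc_inv_le L M a ha k) (norm_nonneg _) (by rw [mul_one]; exact hz.nonneg.1)
      _ = α * Cst d a := by rw [mul_one]
  opNorm_inv_mul_P_le := fun k => by
    have hC := Cst_nonneg d a
    rw [← Matrix.mul_assoc]
    calc _ ≤ ‖(Dc L M a ha (o := o) k)⁻¹ * siteMul (z k)‖ * ‖T k‖ := Matrix.l2_opNorm_mul _ _
      _ ≤ (Cst d a * α) * 1 := mul_le_mul ((Matrix.l2_opNorm_mul _ _).trans (mul_le_mul (opNorm_Dc_inv_le L M a ha k)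
          (opNorm_siteMul_le _ hz.nonneg.1 (hz.bound k)) (norm_nonneg _) hC)) (hT.opNorm_le k) (norm_nonneg _) (mul_nonneg hC hz.nonneg.1)
      _ = α * Cst d a := by rw [mul_one, mul_comm]
  consistent_le := fun k => by
    have hC := Cst_nonneg d a
    have hlev : (0 : ℝ) < (lev L k : ℕ) := by exact_mod_cast one_le_lev' L k
    -- `P′J − JP = siteMul z′ (T′J − JT) + siteMul (z′ − z∘par) J T`
    have e : siteMul (z (k + 1)) * T (k + 1) * Jc L M (o := o) k - Jc L M (o := o) k * (siteMul (z k) * T k)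
        = siteMul (z (k + 1)) * (T (k + 1) * Jc L M (o := o) k - Jc L M (o := o) k * T k)
          + siteMul (fun i => z (k + 1) i - z k (parT (lev L k) L M i)) * Jc L M (o := o) k * T k := by
      rw [← Matrix.mul_assoc (Jc L M k), Jc_mul_siteMul, siteMul_sub]
      simp only [Matrix.mul_sub, Matrix.sub_mul, Matrix.mul_assoc]; abel
    rw [e, Matrix.mul_add, Matrix.add_mul]
    have hG' := opNorm_Dc_inv_le L M a ha (o := o) (k + 1)
    have hG := opNorm_Dc_inv_le L M a ha (o := o) k
    have t1 : ‖(Dc L M a ha (o := o) (k + 1))⁻¹ * (siteMul (z (k + 1)) * (T (k + 1) * Jc L M (o := o) k - Jc L M (o := o) k * T k))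
        * (Dc L M a ha (o := o) k)⁻¹‖ ≤ Cst d a * α * (ct / (lev L k : ℕ)) := by
      have e1 : (Dc L M a ha (o := o) (k + 1))⁻¹ * (siteMul (z (k + 1)) * (T (k + 1) * Jc L M (o := o) k - Jc L M (o := o) k * T k))
          * (Dc L M a ha (o := o) k)⁻¹ = (Dc L M a ha (o := o) (k + 1))⁻¹ * siteMul (z (k + 1))
            * ((T (k + 1) * Jc L M (o := o) k - Jc L M (o := o) k * T k) * (Dc L M a ha (o := o) k)⁻¹) := by
        simp only [Matrix.mul_assoc]
      rw [e1]
      exact (Matrix.l2_opNorm_mul _ _).trans (mul_le_mul ((Matrix.l2_opNorm_mul _ _).trans (mul_le_mul hG'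
        (opNorm_siteMul_le _ hz.nonneg.1 (hz.bound (k + 1))) (norm_nonneg _) hC)) (hT.intertwine_le k) (norm_nonneg _) (mul_nonneg hC hz.nonneg.1))
    have t2 : ‖(Dc L M a ha (o := o) (k + 1))⁻¹ * (siteMul (fun i => z (k + 1) i - z k (parT (lev L k) L M i)) * Jc L M (o := o) k * T k)
        * (Dc L M a ha (o := o) k)⁻¹‖ ≤ Cst d a * (β / (lev L k : ℕ)) * 1 * 1 * Cst d a := by
      have e2 : (Dc L M a ha (o := o) (k + 1))⁻¹ * (siteMul (fun i => z (k + 1) i - z k (parT (lev L k) L M i)) * Jc L M (o := o) k * T k)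
          * (Dc L M a ha (o := o) k)⁻¹ = (Dc L M a ha (o := o) (k + 1))⁻¹ * siteMul (fun i => z (k + 1) i - z k (parT (lev L k) L M i))
            * Jc L M (o := o) k * T k * (Dc L M a ha (o := o) k)⁻¹ := by simp only [Matrix.mul_assoc]
      rw [e2]
      have hβ : 0 ≤ β / (lev L k : ℕ) := div_nonneg hz.nonneg.2 hlev.le
      have h1 : ‖(Dc L M a ha (o := o) (k + 1))⁻¹ * siteMul (fun i => z (k + 1) i - z k (parT (lev L k) L M i))‖ ≤ Cst d a * (β / (lev L k : ℕ)) :=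
        (Matrix.l2_opNorm_mul _ _).trans (mul_le_mul hG' (opNorm_siteMul_le _ hβ (hz.consistent k)) (norm_nonneg _) hC)
      have h2 := (Matrix.l2_opNorm_mul _ _).trans (mul_le_mul h1 (opNorm_kron_le_of_le o (opNorm_JpcT_le L M k)) (norm_nonneg _)
        (mul_nonneg hC hβ))
      have h3 := (Matrix.l2_opNorm_mul _ _).trans (mul_le_mul h2 (hT.opNorm_le k) (norm_nonneg _) (mul_nonneg (mul_nonneg hC hβ) zero_le_one))
      exact (Matrix.l2_opNorm_mul _ _).trans (mul_le_mul h3 hG (norm_nonneg _)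
        (mul_nonneg (mul_nonneg (mul_nonneg hC hβ) zero_le_one) zero_le_one))
    refine ((norm_add_le _ _).trans (add_le_add t1 t2)).trans (le_of_eq ?_)
    rw [cast_lev', inv_pow, div_eq_mul_inv, div_eq_mul_inv]
    ring

/-! ## §2 The instances: forward and backward unit shifts -/

/-- the forward unit shift in direction `μ` on the colour-lifted level space. [folklore] -/
def Sfwd (μ : Fin d) (k : ℕ) : Matrix (idx L M k × o) (idx L M k × o) ℂ := shiftM (fine (lev L k) M) μ ⊗ₖ (1 : Matrix o o ℂ)

/-- the backward unit shift (`S_μᴴ`). [folklore] -/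
def Sbwd (μ : Fin d) (k : ℕ) : Matrix (idx L M k × o) (idx L M k × o) ℂ := (shiftM (fine (lev L k) M) μ)ᴴ ⊗ₖ (1 : Matrix o o ℂ)

section TwoLevel

variable (N R : ℕ) [NeZero N] [NeZero R]

omit [NeZero L] in
/-- `‖F_μ − 1‖ ≤ 1` (a diagonal of `0`s and `−1`s). [folklore] -/
theorem opNorm_faceF_sub_one_le (μ : Fin d) : ‖faceF N R M μ - 1‖ ≤ 1 := by
  have e : faceF N R M μ - 1 = Matrix.diagonal fun i => (if R ∣ (i.1 μ).val + 1 then (1 : ℂ) else 0) - 1 := by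
    rw [faceF, ← Matrix.diagonal_one, ← Matrix.diagonal_sub]
  rw [e]
  refine opNorm_diagonal_le (fine (R * N) M) zero_le_one fun i => ?_
  split_ifs <;> simp

omit [NeZero L] in
/-- **`S′_μJ − JS_μ = (F_μ − 1)·J·(S_μ − 1)`** at two levels. [cite: King1986, (2.10) p.653] [folklore] -/
theorem shift_intertwine (μ : Fin d) :
    shiftM (fine (R * N) M) μ * JK N R M - JK N R M * shiftM (fine N M) μ
      = (faceF N R M μ - 1) * JK N R M * (shiftM (fine N M) μ - 1) := by
  have h := shift_sub_one_mul_JK N R M μ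
  rw [Matrix.sub_mul, Matrix.one_mul, sub_eq_iff_eq_add] at h
  rw [h]
  simp only [Matrix.sub_mul, Matrix.mul_sub, Matrix.one_mul, Matrix.mul_one]
  abel

omit [NeZero L] in
/-- `S_μ S_μᴴ = 1`. [folklore] -/
theorem shiftM_mul_conjTranspose' (μ : Fin d) : shiftM (fine N M) μ * (shiftM (fine N M) μ)ᴴ = 1 :=
  mul_eq_one_comm.mp (conjTranspose_shiftM_mul (fine N M) μ)

omit [NeZero L] in
/-- **`S′ᴴJ − JSᴴ = −S′ᴴ·((F_μ − 1)J)·Sᴴ·(S − 1)`** (from `S′ᴴJ − JSᴴ = −S′ᴴ(S′J − JS)Sᴴ` and `(S − 1)Sᴴ = Sᴴ(S − 1)`). [folklore] -/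
theorem shift_adj_intertwine (μ : Fin d) :
    (shiftM (fine (R * N) M) μ)ᴴ * JK N R M - JK N R M * (shiftM (fine N M) μ)ᴴ
      = -((shiftM (fine (R * N) M) μ)ᴴ * ((faceF N R M μ - 1) * JK N R M) * (shiftM (fine N M) μ)ᴴ
          * (shiftM (fine N M) μ - 1)) := by
  have hc : (shiftM (fine N M) μ - 1) * (shiftM (fine N M) μ)ᴴ = (shiftM (fine N M) μ)ᴴ * (shiftM (fine N M) μ - 1) := by
    rw [Matrix.sub_mul, Matrix.mul_sub, shiftM_mul_conjTranspose', conjTranspose_shiftM_mul, Matrix.one_mul, Matrix.mul_one]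
  have h1 : (shiftM (fine (R * N) M) μ)ᴴ * ((faceF N R M μ - 1) * JK N R M) * (shiftM (fine N M) μ)ᴴ * (shiftM (fine N M) μ - 1)
      = (shiftM (fine (R * N) M) μ)ᴴ * (shiftM (fine (R * N) M) μ * JK N R M - JK N R M * shiftM (fine N M) μ) * (shiftM (fine N M) μ)ᴴ := by
    rw [shift_intertwine, Matrix.mul_assoc _ (shiftM (fine N M) μ)ᴴ, ← hc]
    simp only [Matrix.mul_assoc]
  rw [h1, Matrix.mul_sub, Matrix.sub_mul, ← Matrix.mul_assoc, ← Matrix.mul_assoc, conjTranspose_shiftM_mul, Matrix.one_mul,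
    Matrix.mul_assoc (_ * _) (shiftM (fine N M) μ), shiftM_mul_conjTranspose', Matrix.mul_one]
  abel

/-- the coarse forward shift smooths through the free propagator: `‖(S_μ − 1)𝒢‖ ≤ Cst/N` ((1.89) order one). [cite: Balaban1984PropagatorsI,
Prop. 1.1 (1.89) p.33] [folklore] -/
theorem opNorm_shift_sub_one_mul_calG_le (hN : 1 ≤ N) (μ : Fin d) :
    ‖(shiftM (fine N M) μ - 1) * calG N hN M a ha‖ ≤ Cst d a / N := by
  have hNc : ((N : ℕ) : ℂ) ≠ 0 := by exact_mod_cast (Nat.pos_iff_ne_zero.mp hN)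
  have hNpos : (0 : ℝ) < N := by exact_mod_cast hN
  rw [shiftM_sub_one_eq (fine N M) μ hNc, Matrix.smul_mul, norm_smul, norm_inv, Complex.norm_natCast, div_eq_inv_mul]
  exact mul_le_mul_of_nonneg_left (opNorm_fdiff_calG_le N hN M a ha μ) (inv_nonneg.mpr hNpos.le)

/-- the forward intertwining defect after one free propagator: `‖(S′J − JS)𝒢‖ ≤ Cst/N`. [folklore] -/
theorem opNorm_shift_intertwine_mul_calG_le (hN : 1 ≤ N) (μ : Fin d) :
    ‖(shiftM (fine (R * N) M) μ * JK N R M - JK N R M * shiftM (fine N M) μ) * calG N hN M a ha‖ ≤ Cst d a / N := by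
  rw [shift_intertwine, Matrix.mul_assoc]
  calc _ ≤ ‖(faceF N R M μ - 1) * JK N R M‖ * ‖(shiftM (fine N M) μ - 1) * calG N hN M a ha‖ := Matrix.l2_opNorm_mul _ _
    _ ≤ (1 * 1) * (Cst d a / N) := mul_le_mul ((Matrix.l2_opNorm_mul _ _).trans (mul_le_mul (opNorm_faceF_sub_one_le M N R μ)
        (opNorm_JK_le N R M) (norm_nonneg _) zero_le_one)) (opNorm_shift_sub_one_mul_calG_le M a ha N hN μ) (norm_nonneg _) (by norm_num)
    _ = Cst d a / N := by rw [mul_one, one_mul]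

/-- the backward intertwining defect after one free propagator: `‖(S′ᴴJ − JSᴴ)𝒢‖ ≤ Cst/N`. [folklore] -/
theorem opNorm_shift_adj_intertwine_mul_calG_le (hN : 1 ≤ N) (μ : Fin d) :
    ‖((shiftM (fine (R * N) M) μ)ᴴ * JK N R M - JK N R M * (shiftM (fine N M) μ)ᴴ) * calG N hN M a ha‖ ≤ Cst d a / N := by
  rw [shift_adj_intertwine, Matrix.neg_mul, norm_neg, Matrix.mul_assoc]
  have hS' : ‖(shiftM (fine (R * N) M) μ)ᴴ‖ ≤ 1 := (Matrix.l2_opNorm_conjTranspose _).le.trans (opNorm_shiftM_le _ μ)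
  have hS : ‖(shiftM (fine N M) μ)ᴴ‖ ≤ 1 := (Matrix.l2_opNorm_conjTranspose _).le.trans (opNorm_shiftM_le _ μ)
  have hFJ : ‖(faceF N R M μ - 1) * JK N R M‖ ≤ 1 :=
    (Matrix.l2_opNorm_mul _ _).trans ((mul_le_mul (opNorm_faceF_sub_one_le M N R μ) (opNorm_JK_le N R M) (norm_nonneg _)
      zero_le_one).trans (le_of_eq (mul_one _)))
  have hL3 : ‖(shiftM (fine (R * N) M) μ)ᴴ * ((faceF N R M μ - 1) * JK N R M) * (shiftM (fine N M) μ)ᴴ‖ ≤ 1 :=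
    (Matrix.l2_opNorm_mul _ _).trans ((mul_le_mul ((Matrix.l2_opNorm_mul _ _).trans ((mul_le_mul hS' hFJ (norm_nonneg _)
      zero_le_one).trans (le_of_eq (mul_one _)))) hS (norm_nonneg _) zero_le_one).trans (le_of_eq (mul_one _)))
  calc _ ≤ ‖(shiftM (fine (R * N) M) μ)ᴴ * ((faceF N R M μ - 1) * JK N R M) * (shiftM (fine N M) μ)ᴴ‖
        * ‖(shiftM (fine N M) μ - 1) * calG N hN M a ha‖ := Matrix.l2_opNorm_mul _ _
    _ ≤ 1 * (Cst d a / N) := mul_le_mul hL3 (opNorm_shift_sub_one_mul_calG_le M a ha N hN μ) (norm_nonneg _) zero_le_one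
    _ = Cst d a / N := one_mul _

end TwoLevel

/-- the trivial shift family (`T = 1`, `ct = 0`): `perturbationLaws_siteMul_mul` then recovers the colour zeroth-order law. [folklore] -/
theorem shiftLaws_one : ShiftLaws L M a ha (fun k => (1 : Matrix (idx L M k × o) (idx L M k × o) ℂ)) 0 where
  nonneg := le_rfl
  opNorm_le := fun k => CovariantAveragingTower.opNorm_one_le (ι := fun k => idx L M k × o) k
  intertwine_le := fun k => by rw [Matrix.one_mul, Matrix.mul_one, sub_self, Matrix.zero_mul, norm_zero, zero_div]

/-- **FORWARD SHIFTS OBEY `ShiftLaws` with `ct = Cst`.** [folklore] -/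
theorem shiftLaws_fwd (μ : Fin d) : ShiftLaws L M a ha (Sfwd L M (o := o) μ) (Cst d a) where
  nonneg := Cst_nonneg d a
  opNorm_le := fun k => opNorm_kron_le_of_le o (opNorm_shiftM_le _ μ)
  intertwine_le := fun k => by
    have e : (Sfwd L M (o := o) μ (k + 1) * Jc L M (o := o) k - Jc L M (o := o) k * Sfwd L M (o := o) μ k) * (Dc L M a ha (o := o) k)⁻¹
        = ((shiftM (fine (L * lev L k) M) μ * JK (lev L k) L M - JK (lev L k) L M * shiftM (fine (lev L k) M) μ)
            * calG (lev L k) (one_le_lev' L k) M a ha) ⊗ₖ (1 : Matrix o o ℂ) := by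
      rw [Sfwd, Sfwd, Jc, JpcT_eq_JK, Dc, kron_inv, calDalev_inv, calGlev, ← kron_mul, ← kron_mul, ← sub_kronecker, ← kron_mul]; rfl
    rw [e]
    exact opNorm_kron_le_of_le o (opNorm_shift_intertwine_mul_calG_le M a ha (lev L k) L (one_le_lev' L k) μ)

/-- **BACKWARD SHIFTS OBEY `ShiftLaws` with `ct = Cst`.** [folklore] -/
theorem shiftLaws_bwd (μ : Fin d) : ShiftLaws L M a ha (Sbwd L M (o := o) μ) (Cst d a) where
  nonneg := Cst_nonneg d a
  opNorm_le := fun k => opNorm_kron_le_of_le o ((Matrix.l2_opNorm_conjTranspose (shiftM (fine (lev L k) M) μ)).le.trans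
    (opNorm_shiftM_le _ μ))
  intertwine_le := fun k => by
    have e : (Sbwd L M (o := o) μ (k + 1) * Jc L M (o := o) k - Jc L M (o := o) k * Sbwd L M (o := o) μ k) * (Dc L M a ha (o := o) k)⁻¹
        = (((shiftM (fine (L * lev L k) M) μ)ᴴ * JK (lev L k) L M - JK (lev L k) L M * (shiftM (fine (lev L k) M) μ)ᴴ)
            * calG (lev L k) (one_le_lev' L k) M a ha) ⊗ₖ (1 : Matrix o o ℂ) := by
      rw [Sbwd, Sbwd, Jc, JpcT_eq_JK, Dc, kron_inv, calDalev_inv, calGlev, ← kron_mul, ← kron_mul, ← sub_kronecker, ← kron_mul]; rfl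
    rw [e]
    exact opNorm_kron_le_of_le o (opNorm_shift_adj_intertwine_mul_calG_le M a ha (lev L k) L (one_le_lev' L k) μ)

/-- **THE SHIFTED ZEROTH-ORDER LAW, FORWARD**: `PerturbationLaws (Δ_a⊗1) (k ↦ siteMul (z k)·(S_μ⊗1)) (J⊗1) (αCst) (Cst²(α+β)·L^{−k})`.
[cite: Balaban1985BackgroundPropagators, (3.10) p.392 (shape of the plaquette terms)] [folklore] -/
theorem perturbationLaws_shiftedZerothOrder_fwd {z : (k : ℕ) → idx L M k → Matrix o o ℂ} {α β : ℝ} (hz : BoundedBackgroundM L M z α β)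
    (μ : Fin d) :
    PerturbationLaws (Dc L M a ha) (fun k => siteMul (z k) * Sfwd L M (o := o) μ k) (Jc L M) (α * Cst d a)
      (fun k => Cst d a * (α * Cst d a + β * Cst d a) * ((L : ℝ)⁻¹) ^ k) :=
  perturbationLaws_siteMul_mul L M a ha hz (shiftLaws_fwd L M a ha μ)

/-- **… BACKWARD.** [folklore] -/
theorem perturbationLaws_shiftedZerothOrder_bwd {z : (k : ℕ) → idx L M k → Matrix o o ℂ} {α β : ℝ} (hz : BoundedBackgroundM L M z α β)
    (μ : Fin d) :
    PerturbationLaws (Dc L M a ha) (fun k => siteMul (z k) * Sbwd L M (o := o) μ k) (Jc L M) (α * Cst d a)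
      (fun k => Cst d a * (α * Cst d a + β * Cst d a) * ((L : ℝ)⁻¹) ^ k) :=
  perturbationLaws_siteMul_mul L M a ha hz (shiftLaws_bwd L M a ha μ)

/-- **η-RATE FOR A SHIFTED ZEROTH-ORDER COUPLING** (`L ≥ 2`, all orders in the coupling `t`, `‖t‖·αCst < 1`): the lifted King-averaged unit-lattice
covariances of `(Δ_a^{(k)}⊗1 + t·siteMul(z_k)(S_μ⊗1))⁻¹` CONVERGE with rate `L^{−k}`. [cite: King1986, Lemma 4.5 (4.32)/(4.38) p.674 (scalar template)]
[folklore] -/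
theorem towerLimitRate_shiftedZerothOrder_fwd (hL : 2 ≤ L) {z : (k : ℕ) → idx L M k → Matrix o o ℂ} {α β : ℝ}
    (hz : BoundedBackgroundM L M z α β) (μ : Fin d) {t : ℂ} (ht : ‖t‖ * (α * Cst d a) < 1) :
    TowerLimitRate (Ac L M (o := o)) ((L : ℝ) ^ d) (fun k => (Dc L M a ha k + t • (siteMul (z k) * Sfwd L M (o := o) μ k))⁻¹)
      (Cpert (α * Cst d a) (2 * d * Cst d a) (CJ d a) (Cst d a * (α * Cst d a + β * Cst d a)) 0 t) ((L : ℝ)⁻¹) := by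
  have hL1 : (1 : ℝ) < L := by exact_mod_cast (lt_of_lt_of_le one_lt_two hL : 1 < L)
  have hr : (0 : ℝ) < (L : ℝ) ^ d := pow_pos (lt_trans zero_lt_one hL1) d
  refine towerLimitRate_perturbed hr (freeTowerLaws_c L M a ha) (perturbationLaws_shiftedZerothOrder_fwd L M a ha hz μ)
    (inv_lt_one_of_one_lt₀ hL1) (fun k => le_rfl) (fun k => le_rfl) (fun k => le_rfl) (fun k => ?_) ht
  simp only [zero_mul, le_refl]

/-! ## §3 (appended, same generation) The mixed two-step shift `S_μᴴS_ν ⊗ 1` — the Weitzenböck holonomy terms' carrier -/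

section Mixed

open Summit.QuantumFields.BalabanUV.T4Continuum.BalabanBlockPoincare (transl_add shiftM_eq_transl)

variable (N R : ℕ) [NeZero N] [NeZero R]

omit [NeZero L] in
/-- unit shifts commute (translations on the torus). [folklore] -/
theorem shiftM_comm (μ ν : Fin d) : shiftM (fine N M) μ * shiftM (fine N M) ν = shiftM (fine N M) ν * shiftM (fine N M) μ := by
  rw [shiftM_eq_transl, shiftM_eq_transl, ← transl_add, ← transl_add, add_comm]

omit [NeZero L] in
/-- `(S_μ − 1)S_ν = S_ν(S_μ − 1)`. [folklore] -/
theorem shiftM_sub_one_mul_shiftM (μ ν : Fin d) :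
    (shiftM (fine N M) μ - 1) * shiftM (fine N M) ν = shiftM (fine N M) ν * (shiftM (fine N M) μ - 1) := by
  rw [Matrix.sub_mul, Matrix.mul_sub, Matrix.one_mul, Matrix.mul_one, shiftM_comm]

/-- the mixed intertwining defect after one free propagator: `‖(S′_μᴴS′_νJ − JS_μᴴS_ν)𝒢‖ ≤ 2Cst/N`. [folklore] -/
theorem opNorm_shift_mixed_intertwine_mul_calG_le (hN : 1 ≤ N) (μ ν : Fin d) :
    ‖((shiftM (fine (R * N) M) μ)ᴴ * shiftM (fine (R * N) M) ν * JK N R M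
        - JK N R M * ((shiftM (fine N M) μ)ᴴ * shiftM (fine N M) ν)) * calG N hN M a ha‖ ≤ 2 * Cst d a / N := by
  -- `S′ᴴS′νJ − JSᴴSν = S′ᴴ(S′νJ − JSν) + (S′ᴴJ − JSᴴ)Sν`
  have e : ((shiftM (fine (R * N) M) μ)ᴴ * shiftM (fine (R * N) M) ν * JK N R M
        - JK N R M * ((shiftM (fine N M) μ)ᴴ * shiftM (fine N M) ν)) * calG N hN M a ha
      = (shiftM (fine (R * N) M) μ)ᴴ * ((shiftM (fine (R * N) M) ν * JK N R M - JK N R M * shiftM (fine N M) ν) * calG N hN M a ha)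
        + ((shiftM (fine (R * N) M) μ)ᴴ * JK N R M - JK N R M * (shiftM (fine N M) μ)ᴴ) * shiftM (fine N M) ν * calG N hN M a ha := by
    simp only [Matrix.sub_mul, Matrix.mul_sub, Matrix.mul_assoc]; abel
  -- second term: `(S′ᴴJ − JSᴴ)Sν𝒢 = −S′ᴴ((F−1)J)Sᴴ·Sν·((S − 1)𝒢)`
  have e2 : ((shiftM (fine (R * N) M) μ)ᴴ * JK N R M - JK N R M * (shiftM (fine N M) μ)ᴴ) * shiftM (fine N M) ν * calG N hN M a ha
      = -((shiftM (fine (R * N) M) μ)ᴴ * ((faceF N R M μ - 1) * JK N R M) * (shiftM (fine N M) μ)ᴴ * shiftM (fine N M) ν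
          * ((shiftM (fine N M) μ - 1) * calG N hN M a ha)) := by
    rw [shift_adj_intertwine, Matrix.neg_mul, Matrix.neg_mul, Matrix.mul_assoc _ (shiftM (fine N M) μ - 1) (shiftM (fine N M) ν),
      shiftM_sub_one_mul_shiftM]
    simp only [Matrix.mul_assoc]
  rw [e]
  have hS' : ‖(shiftM (fine (R * N) M) μ)ᴴ‖ ≤ 1 := (Matrix.l2_opNorm_conjTranspose _).le.trans (opNorm_shiftM_le _ μ)
  have hS : ‖(shiftM (fine N M) μ)ᴴ‖ ≤ 1 := (Matrix.l2_opNorm_conjTranspose _).le.trans (opNorm_shiftM_le _ μ)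
  have hSν : ‖shiftM (fine N M) ν‖ ≤ 1 := opNorm_shiftM_le _ ν
  have t1 : ‖(shiftM (fine (R * N) M) μ)ᴴ * ((shiftM (fine (R * N) M) ν * JK N R M - JK N R M * shiftM (fine N M) ν) * calG N hN M a ha)‖
      ≤ 1 * (Cst d a / N) :=
    (Matrix.l2_opNorm_mul _ _).trans (mul_le_mul hS' (opNorm_shift_intertwine_mul_calG_le M a ha N R hN ν) (norm_nonneg _) zero_le_one)
  have hFJ : ‖(faceF N R M μ - 1) * JK N R M‖ ≤ 1 :=
    (Matrix.l2_opNorm_mul _ _).trans ((mul_le_mul (opNorm_faceF_sub_one_le M N R μ) (opNorm_JK_le N R M) (norm_nonneg _)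
      zero_le_one).trans (le_of_eq (mul_one _)))
  have h3 : ‖(shiftM (fine (R * N) M) μ)ᴴ * ((faceF N R M μ - 1) * JK N R M) * (shiftM (fine N M) μ)ᴴ * shiftM (fine N M) ν‖ ≤ 1 := by
    refine (Matrix.l2_opNorm_mul _ _).trans ((mul_le_mul ?_ hSν (norm_nonneg _) zero_le_one).trans (le_of_eq (mul_one _)))
    refine (Matrix.l2_opNorm_mul _ _).trans ((mul_le_mul ?_ hS (norm_nonneg _) zero_le_one).trans (le_of_eq (mul_one _)))
    exact (Matrix.l2_opNorm_mul _ _).trans ((mul_le_mul hS' hFJ (norm_nonneg _) zero_le_one).trans (le_of_eq (mul_one _)))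
  have t2 : ‖((shiftM (fine (R * N) M) μ)ᴴ * JK N R M - JK N R M * (shiftM (fine N M) μ)ᴴ) * shiftM (fine N M) ν * calG N hN M a ha‖
      ≤ 1 * (Cst d a / N) := by
    rw [e2, norm_neg]
    exact (Matrix.l2_opNorm_mul _ _).trans (mul_le_mul h3 (opNorm_shift_sub_one_mul_calG_le M a ha N hN μ) (norm_nonneg _) zero_le_one)
  refine ((norm_add_le _ _).trans (add_le_add t1 t2)).trans (le_of_eq ?_)
  ring

end Mixed

/-- the mixed two-step shift `S_μᴴS_ν ⊗ 1` on the colour-lifted level space (the carrier of the holonomy-defect terms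
`c²(R(∂p_{μν}) − 1)` in the lattice Weitzenböck identity). [folklore] -/
def Smix (μ ν : Fin d) (k : ℕ) : Matrix (idx L M k × o) (idx L M k × o) ℂ :=
  ((shiftM (fine (lev L k) M) μ)ᴴ * shiftM (fine (lev L k) M) ν) ⊗ₖ (1 : Matrix o o ℂ)

/-- **MIXED TWO-STEP SHIFTS OBEY `ShiftLaws` with `ct = 2Cst`.** [folklore] -/
theorem shiftLaws_mixed (μ ν : Fin d) : ShiftLaws L M a ha (Smix L M (o := o) μ ν) (2 * Cst d a) where
  nonneg := mul_nonneg zero_le_two (Cst_nonneg d a)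
  opNorm_le := fun k => opNorm_kron_le_of_le o ((Matrix.l2_opNorm_mul _ _).trans ((mul_le_mul
    ((Matrix.l2_opNorm_conjTranspose (shiftM (fine (lev L k) M) μ)).le.trans (opNorm_shiftM_le _ μ)) (opNorm_shiftM_le _ ν)
    (norm_nonneg _) zero_le_one).trans (le_of_eq (mul_one _))))
  intertwine_le := fun k => by
    have e : (Smix L M (o := o) μ ν (k + 1) * Jc L M (o := o) k - Jc L M (o := o) k * Smix L M (o := o) μ ν k) * (Dc L M a ha (o := o) k)⁻¹
        = (((shiftM (fine (L * lev L k) M) μ)ᴴ * shiftM (fine (L * lev L k) M) ν * JK (lev L k) L M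
            - JK (lev L k) L M * ((shiftM (fine (lev L k) M) μ)ᴴ * shiftM (fine (lev L k) M) ν))
            * calG (lev L k) (one_le_lev' L k) M a ha) ⊗ₖ (1 : Matrix o o ℂ) := by
      rw [Smix, Smix, Jc, JpcT_eq_JK, Dc, kron_inv, calDalev_inv, calGlev, ← kron_mul, ← kron_mul, ← sub_kronecker, ← kron_mul]; rfl
    rw [e]
    exact opNorm_kron_le_of_le o (opNorm_shift_mixed_intertwine_mul_calG_le M a ha (lev L k) L (one_le_lev' L k) μ ν)

/-- **THE SHIFTED ZEROTH-ORDER LAW, MIXED**: `PerturbationLaws (Δ_a⊗1) (k ↦ siteMul (z k)·(S_μᴴS_ν⊗1)) (J⊗1) (αCst) (Cst(2αCst + βCst)·L^{−k})`.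
[cite: Balaban1985BackgroundPropagators, (3.10) p.392 (shape of the plaquette holonomy terms)] [folklore] -/
theorem perturbationLaws_shiftedZerothOrder_mixed {z : (k : ℕ) → idx L M k → Matrix o o ℂ} {α β : ℝ}
    (hz : BoundedBackgroundM L M z α β) (μ ν : Fin d) :
    PerturbationLaws (Dc L M a ha) (fun k => siteMul (z k) * Smix L M (o := o) μ ν k) (Jc L M) (α * Cst d a)
      (fun k => Cst d a * (α * (2 * Cst d a) + β * Cst d a) * ((L : ℝ)⁻¹) ^ k) :=
  perturbationLaws_siteMul_mul L M a ha hz (shiftLaws_mixed L M a ha μ ν)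

end Summit.QuantumFields.BalabanUV.T4Continuum.ShiftedZerothOrder

end
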